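import Literature.AlgebraicGeometry.HodgeTheory.SkewVanishingLatticeUnimodularTransitivity
import HarnessLib

/-!
# Skew-symmetric vanishing lattices, III: JANSSEN'S THEOREM 2.9 — the named fact `HodgeTheory.Janssen1983_thm2_9` HOLDS

W. Janssen, *Skew-symmetric vanishing lattices and their monodromy groups*, Math. Ann. 266 (1983), Thm. 2.9 (as quoted in
D. Baraglia, Math. Ann. 370, Lemma 6.2): «Let `(V, ⟨ , ⟩, Δ)` be an integral vanishing lattice and `x ∈ V`. Then `x ∈ Δ` if
and only if there exists `y ∈ V` and `δ ∈ Δ` such that `⟨x, y⟩ = 1` and `x - δ ∈ 2V`.»  The Literature named fact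
`HodgeTheory.Janssen1983_thm2_9` (`HodgeTheory/SkewVanishingLattice`, rational form with `V = ℤΔ`) is PROVED here, with no
named fact as input.  In print Thm. 2.9 follows from Thm. 2.5 (`Γ_Δ ⊇ Sp♯₂(V)`); here the level-2 moves are produced at the
base pair directly:

* Part 1 `planeEuclid` — Euclid in a hyperbolic plane: units acting as `T_u, T_w` with `⟨u, w⟩ = 1` move every `ε` with
  integral pairings into `u^⊥`;
* Part 2 — the pair moves: for a unimodular pair `u, w ∈ Δ` the group `Γ_Δ` contains `T_δ` (`pairMoves_unit_mem`), the
  shears, `-1` on the plane (`pairMoves_negOnPlane_mem`), the six-squares identity (`pairMoves_sixSquares`, the Heisenberg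
  law), hence the level-2 pair moves `E_{u,m}² : v ↦ v + 2(⟨v,u⟩m + ⟨v,m⟩u)` for every lattice vector `m ⟂ u` once the
  partners of `u` generate (`pairMoves_of_partnersGenerate`);
* Part 3 `partnersGenerate` — JANSSEN'S LEMMA 2.7 ([Schnell2010] §7, proof of Lemma 11): `ℤΔ` is generated by any `u ∈ Δ`
  together with its partners `{δ ∈ Δ : ⟨u, δ⟩ = 1}`, granted the plane Euclid step;
* Part 4 `janssen_lemma2_7`, `pairMoves`, `sqMove_of_mem`, `neg_mem_of_pair`, `movesAtPair`,
  `unimodularTransitivity_skewVanishingLattice` (`Γ_Δ` acts transitively on the unimodular vectors of the class of `δ` modulo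
  `2ℤΔ`, by `unimodularTransitivity_local` of `HodgeTheory/SkewVanishingLatticeUnimodularTransitivity`), and
  **`Literature.AlgebraicGeometry.HodgeTheory.Janssen1983_thm2_9_holds`** — the named fact under its exact name (`⇒`: a
  partner `gδ₂` from the pair of the definition and transitivity; `⇐`: transitivity on the class of `δ`, then
  `Γ_Δ`-stability of `Δ`).

Theorems only: no definition, no NEW named fact (net: one Literature named fact discharged under its exact name).

Provenance: Literature home (namespace `Literature.AlgebraicGeometry.HodgeTheory.VanishingLattice`; the Summits prefix
`localTubeSpan_` dropped, the apex renamed to the fact's `_holds` name) of the declarations used by the Summits-side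
`localTubeSpan_janssen1983_thm2_9_holds` from `HodgeConjecture/Theorems/LinearSystemTorelliLocalTubeSpan{PlaneEuclid, PairMoves,
PartnersGenerate, Thm29}` (route `LinearSystemTorelli`, crux `LocalTubeSpan`; imports Mathlib and `Literature/` only), which
`Literature/` may not import. Lane `lit-hodgefound`, seat p20.

## References

* [Janssen1983] W. A. M. Janssen, *Skew-symmetric vanishing lattices and their monodromy groups*, Math. Ann. 266 (1983)
  115–133, Thm. 2.5, Lemma 2.7, Thm. 2.9.
* [Schnell2010] C. Schnell, *Primitive cohomology and the tube mapping*, Math. Z. 268 (2010), §7, Lemma 11 (proof).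
* [Baraglia2017] D. Baraglia, *Monodromy of the SL(n) and GL(n) Hitchin fibrations*, Math. Ann. 370 (2018), Lemma 6.2.
-/

noncomputable section

namespace Literature.AlgebraicGeometry.HodgeTheory.VanishingLattice

/-! ## Part 1: Euclid in a hyperbolic plane of `ℤΔ` -/

section Part1

open Literature.AlgebraicGeometry.HodgeTheory

/-! ### The four Euclidean moves on the pairings of a unimodular pencil -/

section PlaneEuclidRep

variable {G : Type*} [Group G] {V : Type*} [AddCommGroup V] [Module ℚ V]
  (ρ : G →* (V →ₗ[ℚ] V)) (B : LinearMap.BilinForm ℚ V)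

/-- Pairings after a transvection: if `t` acts as `T_a v = v - B(v, a) a`, then
`B y (t x) = B y x - B x a * B y a`. [cite: Janssen1983, §2 (proof of Thm. 2.9)] -/
theorem planeEuclid_pairing_move (t : G) (a : V) (ht : ∀ v, ρ t v = v - B v a • a)
    (y x : V) : B y (ρ t x) = B y x - B x a * B y a := by
  rw [ht, map_sub, map_smul, smul_eq_mul]

/-- Pairings after an inverse transvection of an alternating form: if `t` acts as
`T_a v = v - B(v, a) a`, then `B y (t⁻¹ x) = B y x + B x a * B y a`. [cite: Janssen1983, §2 (proof of Thm. 2.9)] -/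
theorem planeEuclid_pairing_inv_move (hB : B.IsAlt) (t : G) (a : V)
    (ht : ∀ v, ρ t v = v - B v a • a) (y x : V) : B y (ρ t⁻¹ x) = B y x + B x a * B y a := by
  rw [inv_transvection_formula ρ B hB t a ht, map_add, map_smul, smul_eq_mul]

/-- **Euclid in a unimodular pencil** (representation form).  Let `B` be alternating, `B u w = 1`,
and let `tu, tw ∈ G` act through `ρ` as the transvections `T_u`, `T_w`.  Then every `ε` with
integral pairings `B u ε`, `B w ε` is moved into `u^⊥` by some element of `⟨tu, tw⟩`: Euclid's
algorithm on `(B u ε, B w ε)` with the moves `T_w^{±1} : (b, c) ↦ (b ± c, c)`,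
`T_u^{±1} : (b, c) ↦ (b, c ∓ b)`. [cite: Janssen1983, §2 (proof of Thm. 2.9)] -/
theorem planeEuclid_rep (hB : B.IsAlt) {u w : V} (huw : B u w = 1) (tu tw : G)
    (htu : ∀ v, ρ tu v = v - B v u • u) (htw : ∀ v, ρ tw v = v - B v w • w)
    (ε : V) (hb : ∃ b : ℤ, B u ε = b) (hc : ∃ c : ℤ, B w ε = c) :
    ∃ g ∈ Subgroup.closure ({tu, tw} : Set G), B u (ρ g ε) = 0 := by
  obtain ⟨b, hb⟩ := hb
  obtain ⟨c, hc⟩ := hc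
  have htuH : tu ∈ Subgroup.closure ({tu, tw} : Set G) :=
    Subgroup.subset_closure (Set.mem_insert tu {tw})
  have htwH : tw ∈ Subgroup.closure ({tu, tw} : Set G) :=
    Subgroup.subset_closure (Set.mem_insert_of_mem tu (Set.mem_singleton tw))
  have hwu : B w u = -1 := by rw [← hB.neg_eq, huw]
  -- the four moves (and their trivial companions) on the pairings `(B u x, B w x)`
  have hu_tw : ∀ x, B u (ρ tw x) = B u x + B w x := fun x => by
    rw [planeEuclid_pairing_move ρ B tw w htw, huw, mul_one, ← hB.neg_eq x w,
      ← sub_eq_add_neg]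
  have hw_tw : ∀ x, B w (ρ tw x) = B w x := fun x => by
    rw [planeEuclid_pairing_move ρ B tw w htw, hB.self_eq_zero w, mul_zero, sub_zero]
  have hu_twi : ∀ x, B u (ρ tw⁻¹ x) = B u x - B w x := fun x => by
    rw [planeEuclid_pairing_inv_move ρ B hB tw w htw, huw, mul_one, ← hB.neg_eq x w,
      sub_neg_eq_add]
  have hw_twi : ∀ x, B w (ρ tw⁻¹ x) = B w x := fun x => by
    rw [planeEuclid_pairing_inv_move ρ B hB tw w htw, hB.self_eq_zero w, mul_zero,
      add_zero]
  have hu_tu : ∀ x, B u (ρ tu x) = B u x := fun x => by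
    rw [planeEuclid_pairing_move ρ B tu u htu, hB.self_eq_zero u, mul_zero, sub_zero]
  have hw_tu : ∀ x, B w (ρ tu x) = B w x - B u x := fun x => by
    rw [planeEuclid_pairing_move ρ B tu u htu, hwu, mul_neg, mul_one, ← hB.neg_eq x u]
  have hu_tui : ∀ x, B u (ρ tu⁻¹ x) = B u x := fun x => by
    rw [planeEuclid_pairing_inv_move ρ B hB tu u htu, hB.self_eq_zero u, mul_zero,
      add_zero]
  have hw_tui : ∀ x, B w (ρ tu⁻¹ x) = B w x + B u x := fun x => by
    rw [planeEuclid_pairing_inv_move ρ B hB tu u htu, hwu, mul_neg, mul_one,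
      ← hB.neg_eq x u]
  -- if `g` moves `t ε` into `u^⊥` then `g t` moves `ε` into `u^⊥`
  have step : ∀ {t : G}, t ∈ Subgroup.closure ({tu, tw} : Set G) → ∀ {x : V},
      (∃ g ∈ Subgroup.closure ({tu, tw} : Set G), B u (ρ g (ρ t x)) = 0) →
      ∃ g ∈ Subgroup.closure ({tu, tw} : Set G), B u (ρ g x) = 0 := by
    rintro t ht x ⟨g, hg, h0⟩
    exact ⟨g * t, mul_mem hg ht, by rwa [map_mul, Module.End.mul_apply]⟩
  -- Euclid: strong induction on `|b| + |c|`
  induction hN : b.natAbs + c.natAbs using Nat.strong_induction_on generalizing b c ε with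
  | h N ih =>
  rcases eq_or_ne b 0 with rfl | hb0
  · exact ⟨1, one_mem _, by rw [map_one, Module.End.one_apply, hb, Int.cast_zero]⟩
  rcases eq_or_ne c 0 with rfl | hc0
  · -- `(b, 0) ↦ (b, b) ↦ (0, b)` by `T_u⁻¹` then `T_w⁻¹`
    refine ⟨tw⁻¹ * tu⁻¹, mul_mem (inv_mem htwH) (inv_mem htuH), ?_⟩
    rw [map_mul, Module.End.mul_apply, hu_twi, hu_tui, hw_tui, hc, Int.cast_zero, zero_add,
      sub_self]
  rcases le_or_gt c.natAbs b.natAbs with hle | hlt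
  · -- `0 < |c| ≤ |b|`: decrease `|b|` by `T_w` or `T_w⁻¹`
    rcases (show (b + c).natAbs + c.natAbs < N ∨ (b - c).natAbs + c.natAbs < N by omega)
      with h1 | h1
    · refine step htwH (ih _ h1 (ρ tw ε) (b + c) ?_ c ?_ rfl)
      · rw [hu_tw, hb, hc, Int.cast_add]
      · rw [hw_tw, hc]
    · refine step (inv_mem htwH) (ih _ h1 (ρ tw⁻¹ ε) (b - c) ?_ c ?_ rfl)
      · rw [hu_twi, hb, hc, Int.cast_sub]
      · rw [hw_twi, hc]
  · -- `0 < |b| < |c|`: decrease `|c|` by `T_u` or `T_u⁻¹`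
    rcases (show b.natAbs + (c - b).natAbs < N ∨ b.natAbs + (c + b).natAbs < N by omega)
      with h1 | h1
    · refine step htuH (ih _ h1 (ρ tu ε) b ?_ (c - b) ?_ rfl)
      · rw [hu_tu, hb]
      · rw [hw_tu, hb, hc, Int.cast_sub]
    · refine step (inv_mem htuH) (ih _ h1 (ρ tu⁻¹ ε) b ?_ (c + b) ?_ rfl)
      · rw [hu_tui, hb]
      · rw [hw_tui, hb, hc, Int.cast_add]

end PlaneEuclidRep

/-! ### Units of `End V` -/

section PlaneEuclid

variable {V : Type} [AddCommGroup V] [Module ℚ V]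

/-- **Euclid in a unimodular pencil** (the Euclid step of Janssen's Lemma 2.7).  If units `tu, tw` of `End V` act as the transvections `T_u, T_w` of
an alternating form with `⟨u, w⟩ = 1`, then every `ε` with integral pairings `⟨u, ε⟩, ⟨w, ε⟩` is
moved into `u^⊥` by some element of `⟨tu, tw⟩` (`T_w^{±1} : ⟨u, ε⟩ ↦ ⟨u, ε⟩ ± ⟨w, ε⟩`,
`T_u^{±1} : ⟨w, ε⟩ ↦ ⟨w, ε⟩ ∓ ⟨u, ε⟩`; Euclid on `|⟨u, ε⟩| + |⟨w, ε⟩|`). [cite: Janssen1983, §2 (proof of Thm. 2.9)] -/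
theorem planeEuclid (B : LinearMap.BilinForm ℚ V) (hB : B.IsAlt) {u w : V}
    (huw : B u w = 1) (tu tw : (V →ₗ[ℚ] V)ˣ)
    (htu : ∀ v, ((tu : (V →ₗ[ℚ] V)ˣ) : V →ₗ[ℚ] V) v = v - B v u • u)
    (htw : ∀ v, ((tw : (V →ₗ[ℚ] V)ˣ) : V →ₗ[ℚ] V) v = v - B v w • w)
    (ε : V) (hb : ∃ b : ℤ, B u ε = b) (hc : ∃ c : ℤ, B w ε = c) :
    ∃ g ∈ Subgroup.closure ({tu, tw} : Set (V →ₗ[ℚ] V)ˣ),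
      B u (((g : (V →ₗ[ℚ] V)ˣ) : V →ₗ[ℚ] V) ε) = 0 :=
  planeEuclid_rep (Units.coeHom (V →ₗ[ℚ] V)) B hB huw tu tw htu htw ε hb hc

end PlaneEuclid

end Part1

/-! ## Part 2: The pair moves `x ↦ x + 2(⟨x,e⟩f + ⟨x,f⟩e)` lie in `Γ_Δ` -/

section Part2

open Literature.AlgebraicGeometry.HodgeTheory

variable {V : Type} [AddCommGroup V] [Module ℚ V]

/-! ### Units of the monodromy group: transvections, shears, the `-1` of a unimodular plane -/

section Units

variable (B : LinearMap.BilinForm ℚ V)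

/-- The transvection `T_δ` along a vanishing cycle `δ ∈ Δ` is (the underlying map of) a unit of
`Γ_Δ`. [cite: Janssen1983, §2 (proof of Thm. 2.9)] -/
theorem pairMoves_unit_mem (hB : B.IsAlt) (Δ : Set V) {δ : V} (hδ : δ ∈ Δ) :
    ∃ t ∈ transvectionGroup B Δ, ((t : (V →ₗ[ℚ] V)ˣ) : V →ₗ[ℚ] V) = skewTransvection B δ :=
  ⟨LinearMap.GeneralLinearGroup.ofLinearEquiv (skewTransvectionEquiv B (hB.self_eq_zero δ)),
    unit_skewTransvection_mem_transvectionGroup B hδ (hB.self_eq_zero δ), rfl⟩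

/-- **Integral shears along a vanishing cycle are monodromy**: for `u ∈ Δ` and `k ∈ ℤ` some element
of `Γ_Δ` (the power `T_u^{-k}`) acts as `v ↦ v + k B(v, u) u`. [cite: Janssen1983, §2 (proof of Thm. 2.9)] -/
theorem pairMoves_shear_mem (hB : B.IsAlt) (Δ : Set V) {u : V} (hu : u ∈ Δ) (k : ℤ) :
    ∃ g ∈ transvectionGroup B Δ, ∀ v : V,
      ((g : (V →ₗ[ℚ] V)ˣ) : V →ₗ[ℚ] V) v = v + (k : ℚ) • (B v u • u) := by
  obtain ⟨tu, htuΓ, htu⟩ := pairMoves_unit_mem B hB Δ hu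
  induction k using Int.induction_on with
  | zero =>
    exact ⟨1, one_mem _, fun v => by
      rw [Units.val_one, Module.End.one_apply, Int.cast_zero, zero_smul, add_zero]⟩
  | succ i ih =>
    obtain ⟨g, hg, hgv⟩ := ih
    refine ⟨tu⁻¹ * g, mul_mem (inv_mem htuΓ) hg, fun v => ?_⟩
    rw [Units.val_mul, Module.End.mul_apply, hgv,
      unit_inv_apply B htu (hB.self_eq_zero u)]
    simp only [map_add, map_smul, LinearMap.add_apply, LinearMap.smul_apply, smul_eq_mul,
      hB.self_eq_zero u, mul_zero, add_zero]
    push_cast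
    module
  | pred i ih =>
    obtain ⟨g, hg, hgv⟩ := ih
    refine ⟨tu * g, mul_mem htuΓ hg, fun v => ?_⟩
    rw [Units.val_mul, Module.End.mul_apply, hgv, htu, skewTransvection_apply]
    simp only [map_add, map_smul, LinearMap.add_apply, LinearMap.smul_apply, smul_eq_mul,
      hB.self_eq_zero u, mul_zero, add_zero]
    push_cast
    module

/-- For vanishing cycles `u, y ∈ Δ` with `B(u, y) = 1`, the vector `u + y = T_y⁻¹ u` is a vanishing
cycle (stability of `Δ` under `Γ_Δ`). [cite: Janssen1983, §2 (proof of Thm. 2.9)] -/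
theorem pairMoves_add_mem (hB : B.IsAlt) (Δ : Set V) (hΔ : IsSkewVanishingLattice B Δ) {u y : V} (hu : u ∈ Δ)
    (hy : y ∈ Δ) (huy : B u y = 1) : u + y ∈ Δ := by
  obtain ⟨ty, htyΓ, hty⟩ := pairMoves_unit_mem B hB Δ hy
  have h := hΔ.stable _ (inv_mem htyΓ) u hu
  rwa [unit_inv_apply B hty (hB.self_eq_zero y), huy, one_smul] at h

/-- **The `-1` of a unimodular plane of vanishing cycles is monodromy**: for `u, y ∈ Δ` with
`B(u, y) = 1` the word `T_u² T_y² T_{u+y}² ∈ Γ_Δ` acts as `v ↦ v - 2 (B(v, y) u - B(v, u) y)`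
(`-1` on `ℚu ⊕ ℚy`, the identity on its `B`-orthogonal). [cite: Janssen1983, §2 (proof of Thm. 2.9)] -/
theorem pairMoves_negOnPlane_mem (hB : B.IsAlt) (Δ : Set V) (hΔ : IsSkewVanishingLattice B Δ) {u y : V}
    (hu : u ∈ Δ) (hy : y ∈ Δ) (huy : B u y = 1) :
    ∃ z ∈ transvectionGroup B Δ, ∀ v : V,
      ((z : (V →ₗ[ℚ] V)ˣ) : V →ₗ[ℚ] V) v = v - (2 : ℚ) • (B v y • u - B v u • y) := by
  obtain ⟨tu, htuΓ, htu⟩ := pairMoves_unit_mem B hB Δ hu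
  obtain ⟨ty, htyΓ, hty⟩ := pairMoves_unit_mem B hB Δ hy
  obtain ⟨tuy, htuyΓ, htuy⟩ := pairMoves_unit_mem B hB Δ
    (pairMoves_add_mem B hB Δ hΔ hu hy huy)
  refine ⟨tu * tu * (ty * ty) * (tuy * tuy),
    mul_mem (mul_mem (mul_mem htuΓ htuΓ) (mul_mem htyΓ htyΓ)) (mul_mem htuyΓ htuyΓ), fun v => ?_⟩
  simp only [Units.val_mul, Module.End.mul_apply, htu, hty, htuy]
  exact negOnPlane B hB huy v

end Units

/-! ### The realised pair moves `E_{u,x}²`: six squares and closure properties -/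

section Moves

variable (B : LinearMap.BilinForm ℚ V)

/-- **Six squares.**  For a unimodular pair of vanishing cycles `u, w` (`B(u, w) = 1`) and a vector
`n` orthogonal to both with `w + n ∈ Δ`, the product of the `-1`'s of the planes `(u, w)` and
`(u, w + n)` — the word `T_u² T_w² T_{u+w}² · T_u² T_{w+n}² T_{u+w+n}²` of `Γ_Δ` — acts as the pair
move `E_{u,n}² : v ↦ v + 2 (B(v, u) n + B(v, n) u)`. [cite: Janssen1983, §2 (proof of Thm. 2.9)] -/
theorem pairMoves_sixSquares (hB : B.IsAlt) (Δ : Set V) (hΔ : IsSkewVanishingLattice B Δ) {u w n : V}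
    (hu : u ∈ Δ) (hw : w ∈ Δ) (huw : B u w = 1) (hun : B u n = 0) (hwn : B w n = 0)
    (hwnΔ : w + n ∈ Δ) :
    ∃ g ∈ transvectionGroup B Δ, ∀ v : V,
      ((g : (V →ₗ[ℚ] V)ˣ) : V →ₗ[ℚ] V) v = v + (2 : ℚ) • (B v u • n + B v n • u) := by
  have huwn : B u (w + n) = 1 := by rw [map_add, huw, hun, add_zero]
  obtain ⟨z, hz, hzv⟩ := pairMoves_negOnPlane_mem B hB Δ hΔ hu hw huw
  obtain ⟨z', hz', hz'v⟩ := pairMoves_negOnPlane_mem B hB Δ hΔ hu hwnΔ huwn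
  refine ⟨z * z', mul_mem hz hz', fun v => ?_⟩
  rw [Units.val_mul, Module.End.mul_apply, hz'v, hzv]
  have hwu : B w u = -1 := by rw [← hB.neg_eq, huw]
  have hnu : B n u = 0 := by rw [← hB.neg_eq, hun, neg_zero]
  have hnw : B n w = 0 := by rw [← hB.neg_eq, hwn, neg_zero]
  simp only [map_sub, map_smul, map_add, LinearMap.sub_apply, LinearMap.smul_apply,
    LinearMap.add_apply, smul_eq_mul, huw, hwu, hnu, hnw, hB.self_eq_zero]
  module

/-- The trivial pair move `E_{u,0}² = 1` is realised in `Γ_Δ`. [cite: Janssen1983, §2 (proof of Thm. 2.9)] -/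
theorem pairMoves_zero (Δ : Set V) (u : V) :
    ∃ g ∈ transvectionGroup B Δ, ∀ v : V,
      ((g : (V →ₗ[ℚ] V)ˣ) : V →ₗ[ℚ] V) v = v + (2 : ℚ) • (B v u • (0 : V) + B v (0 : V) • u) :=
  ⟨1, one_mem _, fun v => by
    rw [Units.val_one, Module.End.one_apply, map_zero, zero_smul, smul_zero, add_zero, smul_zero,
      add_zero]⟩

/-- Realised pair moves are closed under negation: for `x ⟂ u` the inverse of an element acting as
`E_{u,x}²` acts as `E_{u,-x}²` (`E_{u,x}² = 1 + 2M` with `M² = 0`). [cite: Janssen1983, §2 (proof of Thm. 2.9)] -/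
theorem pairMoves_neg (hB : B.IsAlt) (Δ : Set V) {u x : V} (hux : B u x = 0)
    (hP : ∃ g ∈ transvectionGroup B Δ, ∀ v : V,
      ((g : (V →ₗ[ℚ] V)ˣ) : V →ₗ[ℚ] V) v = v + (2 : ℚ) • (B v u • x + B v x • u)) :
    ∃ g ∈ transvectionGroup B Δ, ∀ v : V,
      ((g : (V →ₗ[ℚ] V)ˣ) : V →ₗ[ℚ] V) v = v + (2 : ℚ) • (B v u • (-x) + B v (-x) • u) := by
  obtain ⟨g, hg, hgv⟩ := hP
  have hxu : B x u = 0 := by rw [← hB.neg_eq, hux, neg_zero]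
  refine ⟨g⁻¹, inv_mem hg, fun v => ?_⟩
  have h1 : (g : V →ₗ[ℚ] V) (v + (2 : ℚ) • (B v u • (-x) + B v (-x) • u)) = v := by
    rw [hgv]
    simp only [map_add, map_smul, map_neg, LinearMap.add_apply, LinearMap.smul_apply,
      LinearMap.neg_apply, smul_eq_mul, hux, hxu, hB.self_eq_zero]
    module
  calc ((g⁻¹ : (V →ₗ[ℚ] V)ˣ) : V →ₗ[ℚ] V) v
      = ((g⁻¹ : (V →ₗ[ℚ] V)ˣ) : V →ₗ[ℚ] V)
          ((g : V →ₗ[ℚ] V) (v + (2 : ℚ) • (B v u • (-x) + B v (-x) • u))) := by rw [h1]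
    _ = v + (2 : ℚ) • (B v u • (-x) + B v (-x) • u) := units_inv_apply_apply g _

/-- Realised pair moves are closed under sums (the Heisenberg law): for `x, x' ∈ ℤΔ` orthogonal to
`u ∈ Δ`, if elements of `Γ_Δ` act as `E_{u,x}²` and `E_{u,x'}²`, then their product acts as
`E_{u,x+x'}²` followed by `v ↦ v + 4 B(x', x) B(v, u) u`, and `B(x', x) ∈ ℤ`, so composing with the
shear `T_u^{4 B(x', x)} ∈ Γ_Δ` realises `E_{u,x+x'}²`. [cite: Janssen1983, §2 (proof of Thm. 2.9)] -/
theorem pairMoves_add (hB : B.IsAlt) (Δ : Set V) (hint : ∀ δ ∈ Δ, ∀ δ' ∈ Δ, ∃ n : ℤ, B δ δ' = n) {u x x' : V}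
    (hu : u ∈ Δ) (hx : x ∈ Submodule.span ℤ Δ) (hx' : x' ∈ Submodule.span ℤ Δ) (hux : B u x = 0)
    (hux' : B u x' = 0)
    (hP : ∃ g ∈ transvectionGroup B Δ, ∀ v : V,
      ((g : (V →ₗ[ℚ] V)ˣ) : V →ₗ[ℚ] V) v = v + (2 : ℚ) • (B v u • x + B v x • u))
    (hP' : ∃ g ∈ transvectionGroup B Δ, ∀ v : V,
      ((g : (V →ₗ[ℚ] V)ˣ) : V →ₗ[ℚ] V) v = v + (2 : ℚ) • (B v u • x' + B v x' • u)) :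
    ∃ g ∈ transvectionGroup B Δ, ∀ v : V,
      ((g : (V →ₗ[ℚ] V)ˣ) : V →ₗ[ℚ] V) v = v + (2 : ℚ) • (B v u • (x + x') + B v (x + x') • u) := by
  obtain ⟨g, hg, hgv⟩ := hP
  obtain ⟨g', hg', hg'v⟩ := hP'
  obtain ⟨β, hβ⟩ := integral_span B Δ hint hx' hx
  obtain ⟨c, hc, hcv⟩ := pairMoves_shear_mem B hB Δ hu (-(4 * β))
  have hxu : B x u = 0 := by rw [← hB.neg_eq, hux, neg_zero]
  have hx'u : B x' u = 0 := by rw [← hB.neg_eq, hux', neg_zero]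
  refine ⟨c * (g * g'), mul_mem hc (mul_mem hg hg'), fun v => ?_⟩
  rw [Units.val_mul, Units.val_mul, Module.End.mul_apply, Module.End.mul_apply, hg'v, hgv, hcv]
  simp only [map_add, map_smul, LinearMap.add_apply, LinearMap.smul_apply, smul_eq_mul, hux, hxu,
    hx'u, hB.self_eq_zero, hβ]
  push_cast
  module

/-- Realised pair moves are closed under integer multiples: for `x ∈ ℤΔ` orthogonal to `u ∈ Δ`, if
`E_{u,x}²` is realised in `Γ_Δ` then so is `E_{u,kx}²` for every `k ∈ ℤ`. [cite: Janssen1983, §2 (proof of Thm. 2.9)] -/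
theorem pairMoves_zsmul (hB : B.IsAlt) (Δ : Set V) (hint : ∀ δ ∈ Δ, ∀ δ' ∈ Δ, ∃ n : ℤ, B δ δ' = n) {u x : V}
    (hu : u ∈ Δ) (hx : x ∈ Submodule.span ℤ Δ) (hux : B u x = 0)
    (hP : ∃ g ∈ transvectionGroup B Δ, ∀ v : V,
      ((g : (V →ₗ[ℚ] V)ˣ) : V →ₗ[ℚ] V) v = v + (2 : ℚ) • (B v u • x + B v x • u)) (k : ℤ) :
    ∃ g ∈ transvectionGroup B Δ, ∀ v : V,
      ((g : (V →ₗ[ℚ] V)ˣ) : V →ₗ[ℚ] V) v = v + (2 : ℚ) • (B v u • (k • x) + B v (k • x) • u) := by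
  have hukx : ∀ j : ℤ, B u (j • x) = 0 := fun j => by rw [map_zsmul, hux, smul_zero]
  induction k using Int.induction_on with
  | zero =>
    rw [zero_smul]
    exact pairMoves_zero B Δ u
  | succ i ih =>
    rw [add_smul, one_smul]
    exact pairMoves_add B hB Δ hint hu (Submodule.smul_mem _ _ hx) hx (hukx _) hux
      ih hP
  | pred i ih =>
    rw [sub_smul, one_smul, sub_eq_add_neg]
    exact pairMoves_add B hB Δ hint hu (Submodule.smul_mem _ _ hx)
      (Submodule.neg_mem _ hx) (hukx _) (by rw [map_neg, hux, neg_zero]) ih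
      (pairMoves_neg B hB Δ hux hP)

end Moves

/-! ### Generation from the partners of `u`, and the main theorem -/

section Generation

variable (B : LinearMap.BilinForm ℚ V)

/-- **Generation.**  For a unimodular pair of vanishing cycles `u, w` (`B(u, w) = 1`) and the
projection `π x = x - B(x, w) u + B(x, u) w` of `V` onto the `B`-orthogonal of the plane `(u, w)`,
the pair move `E_{u,πx}²` is realised in `Γ_Δ` for every `x` in the `ℤ`-span of `u` and the partners
`{δ ∈ Δ | B(u, δ) = 1}` of `u`: `π u = 0`; for a partner `δ`, `w + π δ = δ - B(δ, w) u = T_u^{B(δ,w)} δ`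
is a vanishing cycle, so the six squares realise `E_{u,πδ}²`; and the realised moves are closed under
sums and integer multiples. [cite: Janssen1983, §2 (proof of Thm. 2.9)] -/
theorem pairMoves_proj (hB : B.IsAlt) (Δ : Set V) (hΔ : IsSkewVanishingLattice B Δ) {u w : V} (hu : u ∈ Δ)
    (hw : w ∈ Δ) (huw : B u w = 1) {x : V}
    (hx : x ∈ Submodule.span ℤ (insert u {δ ∈ Δ | B u δ = 1})) :
    ∃ g ∈ transvectionGroup B Δ, ∀ v : V,
      ((g : (V →ₗ[ℚ] V)ˣ) : V →ₗ[ℚ] V) v =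
        v + (2 : ℚ) • (B v u • (x - B x w • u + B x u • w) + B v (x - B x w • u + B x u • w) • u) := by
  have hsub : insert u {δ ∈ Δ | B u δ = 1} ⊆ Δ := Set.insert_subset hu fun δ hδ => hδ.1
  have hwu : B w u = -1 := by rw [← hB.neg_eq, huw]
  -- the projection is orthogonal to `u` and `w`
  have hπu : ∀ x : V, B u (x - B x w • u + B x u • w) = 0 := fun x => by
    simp only [map_add, map_sub, map_smul, smul_eq_mul, hB.self_eq_zero, huw]
    rw [← hB.neg_eq x u]
    ring
  have hπw : ∀ x : V, B w (x - B x w • u + B x u • w) = 0 := fun x => by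
    simp only [map_add, map_sub, map_smul, smul_eq_mul, hB.self_eq_zero, hwu]
    rw [← hB.neg_eq x w]
    ring
  -- the projection preserves the lattice
  have hπmem : ∀ x ∈ Submodule.span ℤ Δ, x - B x w • u + B x u • w ∈ Submodule.span ℤ Δ := by
    intro x hx
    obtain ⟨a, ha⟩ := integral_span B Δ hΔ.integral hx (Submodule.subset_span hw)
    obtain ⟨b, hb⟩ := integral_span B Δ hΔ.integral hx (Submodule.subset_span hu)
    rw [ha, hb]
    exact Submodule.add_mem _ (Submodule.sub_mem _ hx
      (intCast_smul_mem Δ (Submodule.subset_span hu) a))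
      (intCast_smul_mem Δ (Submodule.subset_span hw) b)
  induction hx using Submodule.span_induction with
  | mem x hx =>
    rcases hx with hxeq | ⟨hxΔ, hux⟩
    · -- `π u = 0`
      have h0 : x - B x w • u + B x u • w = 0 := by
        rw [hxeq, huw, hB.self_eq_zero, one_smul, zero_smul, sub_self, add_zero]
      rw [h0]
      exact pairMoves_zero B Δ u
    · -- a partner `δ = x`: `w + π δ = δ - B(δ, w) u ∈ Δ`, then the six squares
      obtain ⟨α, hα⟩ := hΔ.integral x hxΔ w hw
      obtain ⟨c, hc, hcv⟩ := pairMoves_shear_mem B hB Δ hu α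
      have hxu : B x u = -1 := by rw [← hB.neg_eq, hux]
      have hmem : w + (x - B x w • u + B x u • w) ∈ Δ := by
        have h := hΔ.stable c hc x hxΔ
        rw [hcv, hxu] at h
        convert h using 1
        rw [hα, hxu]
        module
      exact pairMoves_sixSquares B hB Δ hΔ hu hw huw (hπu x) (hπw x) hmem
  | zero =>
    have h0 : (0 : V) - B (0 : V) w • u + B (0 : V) u • w = 0 := by
      rw [map_zero, LinearMap.zero_apply, LinearMap.zero_apply, zero_smul, zero_smul, sub_zero,
        add_zero]
    rw [h0]
    exact pairMoves_zero B Δ u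
  | add x y hx hy ihx ihy =>
    have hadd : x + y - B (x + y) w • u + B (x + y) u • w =
        (x - B x w • u + B x u • w) + (y - B y w • u + B y u • w) := by
      simp only [map_add, LinearMap.add_apply]
      module
    rw [hadd]
    exact pairMoves_add B hB Δ hΔ.integral hu (hπmem x (Submodule.span_mono hsub hx))
      (hπmem y (Submodule.span_mono hsub hy)) (hπu x) (hπu y) ihx ihy
  | smul k x hx ih =>
    have hsmul : k • x - B (k • x) w • u + B (k • x) u • w = k • (x - B x w • u + B x u • w) := by
      simp only [← Int.cast_smul_eq_zsmul ℚ k, map_smul, LinearMap.smul_apply, smul_eq_mul]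
      module
    rw [hsmul]
    exact pairMoves_zsmul B hB Δ hΔ.integral hu
      (hπmem x (Submodule.span_mono hsub hx)) (hπu x) ih k

end Generation

/-- **The level-2 pair moves along a unimodular vanishing cycle lie in the monodromy group**
(the first elementary family of Janssen's `Sp♯₂(ℤΔ) ≤ Γ_Δ`, obtained here WITHOUT Theorem 2.5).  Let `Δ` be a skew vanishing
lattice of the alternating form `B`, `u, w ∈ Δ` with `B(u, w) = 1`, and grant Janssen's Lemma 2.7 at
`u`: `ℤΔ` is spanned by `u` and the partners `{δ ∈ Δ | B(u, δ) = 1}`.  Then for every `m ∈ ℤΔ` with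
`B(u, m) = 0` some element of `Γ_Δ` acts as `E_{u,m}² : v ↦ v + 2 (B(v, u) m + B(v, m) u)`.
(`m = π m + B(m, w) u` with `π` the projection onto `{u, w}^⊥`; the move along `π m` is realised by
`pairMoves_proj`, and `E_{u,m}² = T_u^{-4B(m,w)} ∘ E_{u,πm}²`.)
[cite: Janssen1983, Thm. 2.5] -/
theorem pairMoves_of_partnersGenerate (B : LinearMap.BilinForm ℚ V) (hB : B.IsAlt)
    (Δ : Set V) (hΔ : IsSkewVanishingLattice B Δ) {u w : V} (hu : u ∈ Δ) (hw : w ∈ Δ)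
    (huw : B u w = 1)
    (hgen : Submodule.span ℤ (insert u {δ ∈ Δ | B u δ = 1}) = Submodule.span ℤ Δ)
    {m : V} (hm : m ∈ Submodule.span ℤ Δ) (hum : B u m = 0) :
    ∃ g ∈ transvectionGroup B Δ, ∀ v : V,
      ((g : (V →ₗ[ℚ] V)ˣ) : V →ₗ[ℚ] V) v = v + (2 : ℚ) • (B v u • m + B v m • u) := by
  have hm' : m ∈ Submodule.span ℤ (insert u {δ ∈ Δ | B u δ = 1}) := by rwa [hgen]
  obtain ⟨g, hg, hgv⟩ := pairMoves_proj B hB Δ hΔ hu hw huw hm'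
  obtain ⟨β, hβ⟩ := integral_span B Δ hΔ.integral hm (Submodule.subset_span hw)
  obtain ⟨c, hc, hcv⟩ := pairMoves_shear_mem B hB Δ hu (4 * β)
  have hmu : B m u = 0 := by rw [← hB.neg_eq, hum, neg_zero]
  have hwu : B w u = -1 := by rw [← hB.neg_eq, huw]
  refine ⟨c * g, mul_mem hc hg, fun v => ?_⟩
  rw [Units.val_mul, Module.End.mul_apply, hgv, hcv]
  simp only [map_add, map_sub, map_smul, LinearMap.add_apply, LinearMap.sub_apply,
    LinearMap.smul_apply, smul_eq_mul, hβ, hmu, hwu, hB.self_eq_zero]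
  push_cast
  module

end Part2

/-! ## Part 3: Janssen's Lemma 2.7: partners generate -/

section Part3

open Literature.AlgebraicGeometry.HodgeTheory

/-! ### Two stability lemmas -/

section Stability

variable {V : Type} [AddCommGroup V] [Module ℚ V]

/-- If `⟨x, a⟩ a` lies in the lattice `ℤS` for every generator `x ∈ S`, then it does for every
`x ∈ ℤS` (the map `x ↦ ⟨x, a⟩ a` is additive). [cite: Janssen1983, §2 (proof of Thm. 2.9)] -/
theorem smul_mem_span_int_of_generators (B : LinearMap.BilinForm ℚ V) (S : Set V)
    (a : V) (hS : ∀ x ∈ S, B x a • a ∈ Submodule.span ℤ S) {x : V}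
    (hx : x ∈ Submodule.span ℤ S) : B x a • a ∈ Submodule.span ℤ S := by
  induction hx using Submodule.span_induction with
  | mem x hx => exact hS x hx
  | zero =>
    rw [map_zero, LinearMap.zero_apply, zero_smul]
    exact zero_mem _
  | add x y _ _ hx hy =>
    rw [map_add, LinearMap.add_apply, add_smul]
    exact add_mem hx hy
  | smul n x _ hx =>
    rw [← Int.cast_smul_eq_zsmul ℚ n x, map_smul, LinearMap.smul_apply, smul_eq_mul, mul_smul,
      Int.cast_smul_eq_zsmul]
    exact Submodule.smul_mem _ n hx

/-- The subgroup of `GL(V)` generated by units acting as transvections `T_a` (`⟨a, a⟩ = 0`) maps a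
subgroup `N ≤ V` into itself as soon as `⟨x, a⟩ a ∈ N` for all `x ∈ N` and all these `a`
(`T_a^{±1} x = x ∓ ⟨x, a⟩ a`). [cite: Janssen1983, §2 (proof of Thm. 2.9)] -/
theorem closure_map_mem_of_transvections (B : LinearMap.BilinForm ℚ V)
    (N : Submodule ℤ V) (S : Set (V →ₗ[ℚ] V)ˣ)
    (hS : ∀ t ∈ S, ∃ a : V, (t : V →ₗ[ℚ] V) = skewTransvection B a ∧ B a a = 0 ∧
      ∀ x ∈ N, B x a • a ∈ N)
    {g : (V →ₗ[ℚ] V)ˣ} (hg : g ∈ Subgroup.closure S) {x : V} (hx : x ∈ N) :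
    (g : V →ₗ[ℚ] V) x ∈ N := by
  induction hg using Subgroup.closure_induction'' generalizing x with
  | mem t ht =>
    obtain ⟨a, hta, -, hN⟩ := hS t ht
    rw [hta, skewTransvection_apply]
    exact sub_mem hx (hN x hx)
  | inv_mem t ht =>
    obtain ⟨a, hta, haa, hN⟩ := hS t ht
    rw [unit_inv_apply B hta haa]
    exact add_mem hx (hN x hx)
  | one => rwa [Units.val_one, Module.End.one_apply]
  | mul g h _ _ ihg ihh =>
    rw [Units.val_mul, Module.End.mul_apply]
    exact ihg (ihh hx)

end Stability

/-! ### Janssen's Lemma 2.7 -/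

section PartnersGenerate

variable {V : Type} [AddCommGroup V] [Module ℚ V]

/-- **Janssen's Lemma 2.7** ([Schnell2010] §7, proof of Lemma 11: "`V` is already generated by the
smaller set `Δ₁ = {δ ∈ Δ : ⟨δ₁, δ⟩ = 1 or δ = δ₁}`"), granting the pencil Euclid step
(`planeEuclid`) as the hypothesis `heuclid`: for a skew-symmetric vanishing
lattice `Δ` of an alternating form and `u ∈ Δ`, the lattice `ℤΔ` is generated by `u` and the
partners `{δ ∈ Δ : ⟨u, δ⟩ = 1}` of `u`.  (The span `M₁` contains a partner `w`; for `ε ∈ Δ ∩ u^⊥`,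
`T_ε` maps partners to partners, so `T_ε^{±1} M₁ ⊆ M₁`; a general `ε ∈ Δ` is `g⁻¹ ε'` with
`ε' = g ε ∈ Δ ∩ u^⊥` and `g ∈ ⟨T_u, T_w⟩` preserving `M₁`; so `M₁` is `Γ_Δ`-stable and contains
`Δ = Γ_Δ u`.) [cite: Schnell2010, §7 proof of Lemma 11] -/
theorem partnersGenerate (B : LinearMap.BilinForm ℚ V) (hB : B.IsAlt) (Δ : Set V)
    (hΔ : IsSkewVanishingLattice B Δ)
    (heuclid : ∀ {u w : V}, B u w = 1 → ∀ (tu tw : (V →ₗ[ℚ] V)ˣ),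
      (∀ v, ((tu : (V →ₗ[ℚ] V)ˣ) : V →ₗ[ℚ] V) v = v - B v u • u) →
      (∀ v, ((tw : (V →ₗ[ℚ] V)ˣ) : V →ₗ[ℚ] V) v = v - B v w • w) →
      ∀ ε : V, (∃ b : ℤ, B u ε = b) → (∃ c : ℤ, B w ε = c) →
        ∃ g ∈ Subgroup.closure ({tu, tw} : Set (V →ₗ[ℚ] V)ˣ),
          B u (((g : (V →ₗ[ℚ] V)ˣ) : V →ₗ[ℚ] V) ε) = 0)
    {u : V} (hu : u ∈ Δ) :
    Submodule.span ℤ (insert u {δ ∈ Δ | B u δ = 1}) = Submodule.span ℤ Δ := by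
  set M₁ : Submodule ℤ V := Submodule.span ℤ (insert u {δ ∈ Δ | B u δ = 1}) with hM₁
  have hsub : insert u {δ ∈ Δ | B u δ = 1} ⊆ Δ := Set.insert_subset hu fun δ hδ => hδ.1
  have hle : M₁ ≤ Submodule.span ℤ Δ := Submodule.span_mono hsub
  refine le_antisymm hle (Submodule.span_le.mpr ?_)
  -- the generators of `M₁`
  have huM : u ∈ M₁ := Submodule.subset_span (Set.mem_insert u _)
  have hpartner : ∀ δ ∈ Δ, B u δ = 1 → δ ∈ M₁ := fun δ hδ h1 =>
    Submodule.subset_span (Set.mem_insert_of_mem u ⟨hδ, h1⟩)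
  -- integrality of `B` on `M₁ × Δ`
  have hint : ∀ x ∈ M₁, ∀ δ ∈ Δ, ∃ n : ℤ, B x δ = n := fun x hx δ hδ =>
    exists_int_eq_of_mem_span_int B Δ δ (fun y hy => hΔ.integral y hy δ hδ) (hle hx)
  -- the units `T_a ∈ GL(V)`, `a ∈ V`
  obtain ⟨T, hTval⟩ : ∃ T : V → (V →ₗ[ℚ] V)ˣ,
      ∀ a, ((T a : (V →ₗ[ℚ] V)ˣ) : V →ₗ[ℚ] V) = skewTransvection B a :=
    ⟨fun a => LinearMap.GeneralLinearGroup.ofLinearEquiv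
        (skewTransvectionEquiv B (hB.self_eq_zero a)), fun a => rfl⟩
  have hTapply : ∀ a v, ((T a : (V →ₗ[ℚ] V)ˣ) : V →ₗ[ℚ] V) v = v - B v a • a := fun a v => by
    rw [hTval, skewTransvection_apply]
  have hTmem : ∀ a ∈ Δ, T a ∈ transvectionGroup B Δ := fun a ha =>
    Subgroup.subset_closure ⟨a, ha, hTval a⟩
  -- (a) a partner `w` of `u`
  obtain ⟨δ₁, hδ₁, δ₂, hδ₂, h12⟩ := hΔ.exists_pair
  obtain ⟨g₀, hg₀, hg₀u⟩ := hΔ.transitive δ₁ hδ₁ u hu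
  obtain ⟨w, hwΔ, huw⟩ : ∃ w ∈ Δ, B u w = 1 :=
    ⟨(g₀ : V →ₗ[ℚ] V) δ₂, hΔ.stable g₀ hg₀ δ₂ hδ₂, by
      rw [← hg₀u, transvectionGroup_isometry B hB Δ hg₀, h12]⟩
  have hwM : w ∈ M₁ := hpartner w hwΔ huw
  -- `P a` := "`⟨x, a⟩ a ∈ M₁` for all `x ∈ M₁`"; trivial for `a ∈ Δ ∩ M₁`
  have hP_of_mem : ∀ a ∈ Δ, a ∈ M₁ → ∀ x ∈ M₁, B x a • a ∈ M₁ := by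
    intro a haΔ haM x hx
    obtain ⟨n, hn⟩ := hint x hx a haΔ
    rw [hn, Int.cast_smul_eq_zsmul]
    exact M₁.smul_mem n haM
  -- (b) `P ε` for `ε ∈ Δ ∩ u^⊥`: `T_ε` maps partners to partners
  have hP_orth : ∀ ε ∈ Δ, B u ε = 0 → ∀ x ∈ M₁, B x ε • ε ∈ M₁ := by
    intro ε hε huε x hx
    refine smul_mem_span_int_of_generators B _ ε (fun y hy => ?_) hx
    rcases Set.mem_insert_iff.mp hy with hyu | ⟨hyΔ, huy⟩
    · rw [hyu, huε, zero_smul]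
      exact zero_mem _
    · have hTy : y - B y ε • ε ∈ Δ := by
        have h := hΔ.stable _ (hTmem ε hε) y hyΔ
        rwa [hTapply] at h
      have hTy1 : B u (y - B y ε • ε) = 1 := by
        rw [map_sub, map_smul, smul_eq_mul, huy, huε, mul_zero, sub_zero]
      have h := sub_mem (hpartner y hyΔ huy) (hpartner _ hTy hTy1)
      rwa [sub_sub_cancel] at h
  -- (c) `P ε` for every `ε ∈ Δ`: conjugate into `u^⊥` by `⟨T_u, T_w⟩`
  have hP : ∀ ε ∈ Δ, ∀ x ∈ M₁, B x ε • ε ∈ M₁ := by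
    intro ε hε
    obtain ⟨g, hg, hg0⟩ := heuclid huw (T u) (T w) (hTapply u) (hTapply w) ε
      (hΔ.integral u hu ε hε) (hΔ.integral w hwΔ ε hε)
    have hH : Subgroup.closure ({T u, T w} : Set (V →ₗ[ℚ] V)ˣ) ≤ transvectionGroup B Δ := by
      rw [Subgroup.closure_le]
      rintro t ht
      rcases ht with rfl | rfl
      exacts [hTmem u hu, hTmem w hwΔ]
    have hgΓ : g ∈ transvectionGroup B Δ := hH hg
    have hε' : (g : V →ₗ[ℚ] V) ε ∈ Δ := hΔ.stable g hgΓ ε hε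
    -- `⟨T_u, T_w⟩` maps `M₁` into itself
    have hpres : ∀ h ∈ Subgroup.closure ({T u, T w} : Set (V →ₗ[ℚ] V)ˣ), ∀ x ∈ M₁,
        (h : V →ₗ[ℚ] V) x ∈ M₁ := fun h hh x hx =>
      closure_map_mem_of_transvections B M₁ {T u, T w} (by
        rintro t ht
        rcases ht with rfl | rfl
        · exact ⟨u, hTval u, hB.self_eq_zero u, hP_of_mem u hu huM⟩
        · exact ⟨w, hTval w, hB.self_eq_zero w, hP_of_mem w hwΔ hwM⟩) hh hx
    intro x hx
    have h1 : B ((g : V →ₗ[ℚ] V) x) ((g : V →ₗ[ℚ] V) ε) • (g : V →ₗ[ℚ] V) ε ∈ M₁ :=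
      hP_orth _ hε' hg0 _ (hpres g hg x hx)
    have h2 : (g : V →ₗ[ℚ] V) (B x ε • ε) ∈ M₁ := by
      rw [map_smul, ← transvectionGroup_isometry B hB Δ hgΓ x ε]
      exact h1
    have h3 := hpres g⁻¹ (inv_mem hg) _ h2
    rwa [units_inv_apply_apply] at h3
  -- (d) `Γ_Δ` maps `M₁` into itself
  have hΓ : ∀ g ∈ transvectionGroup B Δ, ∀ x ∈ M₁, (g : V →ₗ[ℚ] V) x ∈ M₁ := fun g hg x hx =>
    closure_map_mem_of_transvections B M₁
      {t | ∃ δ ∈ Δ, (t : V →ₗ[ℚ] V) = skewTransvection B δ}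
      (fun t ht => by
        obtain ⟨δ, hδ, htδ⟩ := ht
        exact ⟨δ, htδ, hB.self_eq_zero δ, hP δ hδ⟩) hg hx
  -- (e) `Δ = Γ_Δ · u ⊆ M₁`
  intro δ hδ
  obtain ⟨g, hg, hgu⟩ := hΔ.transitive u hu δ hδ
  rw [← hgu]
  exact hΓ g hg u huM

end PartnersGenerate

end Part3

/-! ## Part 4: Janssen's Theorem 2.9 -/

section Part4

open Literature.AlgebraicGeometry.HodgeTheory

variable {V : Type} [AddCommGroup V] [Module ℚ V]

/-- **Janssen's Lemma 2.7** ([Schnell2010] §7, proof of Lemma 11: "V is already generated by the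
smaller set `Δ₁ = {δ ∈ Δ : ⟨δ₁, δ⟩ = 1 or δ = δ₁}`"), unconditionally: for a skew vanishing lattice and
`u ∈ Δ`, the lattice `ℤΔ` is generated by `u` and the partners of `u`.
[cite: Schnell2010, §7 (proof of Lemma 11)] -/
theorem janssen_lemma2_7 (B : LinearMap.BilinForm ℚ V) (hB : B.IsAlt) (Δ : Set V)
    (hΔ : IsSkewVanishingLattice B Δ) {u : V} (hu : u ∈ Δ) :
    Submodule.span ℤ (insert u {δ ∈ Δ | B u δ = 1}) = Submodule.span ℤ Δ :=
  partnersGenerate B hB Δ hΔ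
    (fun huw tu tw htu htw ε hb hc => planeEuclid B hB huw tu tw htu htw ε hb hc) hu

/-- **Level-2 pair moves along a vanishing cycle are monodromy** (no named fact): for a skew vanishing
lattice, a unimodular pair `u, w ∈ Δ` (`⟨u, w⟩ = 1`) and every lattice vector `m ⟂ u`, some element of
`Γ_Δ` acts as `E_{u,m}² : v ↦ v + 2(⟨v,u⟩m + ⟨v,m⟩u)`. [cite: Janssen1983, Thm. 2.5] -/
theorem pairMoves (B : LinearMap.BilinForm ℚ V) (hB : B.IsAlt) (Δ : Set V)
    (hΔ : IsSkewVanishingLattice B Δ) {u w : V} (hu : u ∈ Δ) (hw : w ∈ Δ) (huw : B u w = 1)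
    {m : V} (hm : m ∈ Submodule.span ℤ Δ) (hum : B u m = 0) :
    ∃ g ∈ transvectionGroup B Δ, ∀ v : V,
      ((g : (V →ₗ[ℚ] V)ˣ) : V →ₗ[ℚ] V) v = v + (2 : ℚ) • (B v u • m + B v m • u) :=
  pairMoves_of_partnersGenerate B hB Δ hΔ hu hw huw
    (janssen_lemma2_7 B hB Δ hΔ hu) hm hum

/-- Squares of transvections along elements of `Δ` are moves of `Γ_Δ`: some `g ∈ Γ_Δ` acts as
`v ↦ v - 2⟨v, δ⟩δ`. [cite: Janssen1983, §2 (proof of Thm. 2.9)] -/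
theorem sqMove_of_mem (B : LinearMap.BilinForm ℚ V) (hB : B.IsAlt) (Δ : Set V)
    {δ : V} (hδ : δ ∈ Δ) :
    ∃ g ∈ transvectionGroup B Δ, ∀ v : V,
      ((g : (V →ₗ[ℚ] V)ˣ) : V →ₗ[ℚ] V) v = v - (2 : ℚ) • (B v δ • δ) := by
  obtain ⟨t, ht, htv⟩ := pairMoves_unit_mem B hB Δ hδ
  refine ⟨t * t, mul_mem ht ht, fun v => ?_⟩
  rw [Units.val_mul, Module.End.mul_apply, htv, skewTransvection_sq_apply B hB]

/-- For a unimodular pair `u, w ∈ Δ` (`⟨u, w⟩ = 1`), `-w ∈ Δ` (`-w = T_u (T_w u)`). [cite: Janssen1983, §2 (proof of Thm. 2.9)] -/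
theorem neg_mem_of_pair (B : LinearMap.BilinForm ℚ V) (hB : B.IsAlt) (Δ : Set V)
    (hΔ : IsSkewVanishingLattice B Δ) {u w : V} (hu : u ∈ Δ) (hw : w ∈ Δ) (huw : B u w = 1) :
    -w ∈ Δ := by
  obtain ⟨tu, htu, htuv⟩ := pairMoves_unit_mem B hB Δ hu
  obtain ⟨tw, htw, htwv⟩ := pairMoves_unit_mem B hB Δ hw
  have hwu : B w u = -1 := by rw [← hB.neg_eq, huw]
  have h := hΔ.stable (tu * tw) (mul_mem htu htw) u hu
  have e : ((tu * tw : (V →ₗ[ℚ] V)ˣ) : V →ₗ[ℚ] V) u = -w := by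
    rw [Units.val_mul, Module.End.mul_apply, htwv, htuv, skewTransvection_apply, skewTransvection_apply,
      huw, one_smul, map_sub, LinearMap.sub_apply, hB.self_eq_zero u, hwu]
    module
  rwa [e] at h

/-- The local moves at a unimodular pair `x, y ∈ Δ`: pair moves at `e ∈ {x, y}` (along `x` with partner
`y`, along `y` with partner `-x`) and the squares of `T_x, T_y, T_{x+y}` — all inside `Γ_Δ`, no named
fact. [cite: Janssen1983, §2 (proof of Thm. 2.9)] -/
theorem movesAtPair (B : LinearMap.BilinForm ℚ V) (hB : B.IsAlt) (Δ : Set V)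
    (hΔ : IsSkewVanishingLattice B Δ) {x y : V} (hx : x ∈ Δ) (hy : y ∈ Δ) (hxy : B x y = 1) :
    (∀ e ∈ ({x, y} : Set V), ∀ f ∈ Submodule.span ℤ Δ, B e f = 0 →
      ∃ g ∈ transvectionGroup B Δ, ∀ v : V,
        ((g : (V →ₗ[ℚ] V)ˣ) : V →ₗ[ℚ] V) v = v + (2 : ℚ) • (B v e • f + B v f • e)) ∧
    (∀ a ∈ ({x, y, x + y} : Set V), ∃ g ∈ transvectionGroup B Δ, ∀ v : V,
        ((g : (V →ₗ[ℚ] V)ˣ) : V →ₗ[ℚ] V) v = v - (2 : ℚ) • (B v a • a)) := by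
  have hxyΔ : x + y ∈ Δ := pairMoves_add_mem B hB Δ hΔ hx hy hxy
  have hnegy : -y ∈ Δ := neg_mem_of_pair B hB Δ hΔ hx hy hxy
  have hnegyx : B (-y) x = 1 := by rw [map_neg, LinearMap.neg_apply, ← hB.neg_eq, neg_neg, hxy]
  have hnegx : -x ∈ Δ := neg_mem_of_pair B hB Δ hΔ hnegy hx hnegyx
  have hyx : B y (-x) = 1 := by rw [map_neg, ← hB.neg_eq, neg_neg, hxy]
  refine ⟨fun e he f hf hef => ?_, fun a ha => ?_⟩
  · simp only [Set.mem_insert_iff, Set.mem_singleton_iff] at he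
    rcases he with rfl | rfl
    · exact pairMoves B hB Δ hΔ hx hy hxy hf hef
    · exact pairMoves B hB Δ hΔ hy hnegx hyx hf hef
  · simp only [Set.mem_insert_iff, Set.mem_singleton_iff] at ha
    have haΔ : a ∈ Δ := by rcases ha with rfl | rfl | rfl <;> assumption
    exact sqMove_of_mem B hB Δ haΔ

/-- **Transitivity of the monodromy group on unimodular vectors of a class** (no named fact): for a
skew vanishing lattice, `δ ∈ Δ` with a partner `y ∈ Δ` (`⟨δ, y⟩ = 1`), every `t ∈ δ + 2ℤΔ` that is
unimodular (`⟨t, y'⟩ = 1` for some `y' ∈ ℤΔ`) is `g δ` for some `g ∈ Γ_Δ`; in particular `t ∈ Δ`.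
[cite: Janssen1983, Thm. 2.9] -/
theorem unimodularTransitivity_skewVanishingLattice (B : LinearMap.BilinForm ℚ V)
    (hB : B.IsAlt) (Δ : Set V) (hΔ : IsSkewVanishingLattice B Δ) {δ y : V} (hδ : δ ∈ Δ)
    (hy : y ∈ Δ) (hδy : B δ y = 1) {t : V} (ht : ∃ z ∈ Submodule.span ℤ Δ, t = δ + (2 : ℚ) • z)
    (htu : ∃ y' ∈ Submodule.span ℤ Δ, B t y' = 1) :
    ∃ g ∈ transvectionGroup B Δ, ((g : (V →ₗ[ℚ] V)ˣ) : V →ₗ[ℚ] V) δ = t := by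
  obtain ⟨hpair, hsq⟩ := movesAtPair B hB Δ hΔ hδ hy hδy
  exact unimodularTransitivity_local B hB Δ hΔ.integral (transvectionGroup B Δ)
    (Submodule.subset_span hδ) (Submodule.subset_span hy) hδy hpair hsq ht htu

/-- **JANSSEN'S THEOREM 2.9 HOLDS** — the named fact `Janssen1983_thm2_9` discharged, with no named
fact as input: for a skew vanishing lattice `Δ` of an alternating form and `x ∈ ℤΔ`, `x ∈ Δ` iff `x` is
unimodular and `x ≡ δ (mod 2ℤΔ)` for some `δ ∈ Δ`.  (`⇒`: a partner `gδ₂` from the pair of the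
definition and transitivity; `⇐`: transitivity of `Γ_Δ` on the unimodular vectors of the class of `δ`,
then `Γ_Δ`-stability of `Δ`.) [cite: Janssen1983, Thm. 2.9] -/
theorem _root_.Literature.AlgebraicGeometry.HodgeTheory.Janssen1983_thm2_9_holds : Janssen1983_thm2_9 := by
  intro W _ _ B hB Δ hΔ x hx
  constructor
  · intro hxΔ
    obtain ⟨δ₁, hδ₁, δ₂, hδ₂, h12⟩ := hΔ.exists_pair
    obtain ⟨g, hg, hgx⟩ := hΔ.transitive δ₁ hδ₁ x hxΔ
    refine ⟨⟨((g : (W →ₗ[ℚ] W)ˣ) : W →ₗ[ℚ] W) δ₂,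
      transvectionGroup_map_span_int B hB Δ hΔ.integral hg (Submodule.subset_span hδ₂),
      ?_⟩, x, hxΔ, 0, Submodule.zero_mem _, by rw [sub_self, smul_zero]⟩
    rw [← hgx, transvectionGroup_isometry B hB Δ hg, h12]
  · rintro ⟨⟨y', hy', hxy'⟩, δ, hδ, z, hz, hxδ⟩
    obtain ⟨δ₁, hδ₁, δ₂, hδ₂, h12⟩ := hΔ.exists_pair
    obtain ⟨g, hg, hgδ⟩ := hΔ.transitive δ₁ hδ₁ δ hδ
    have hyΔ : ((g : (W →ₗ[ℚ] W)ˣ) : W →ₗ[ℚ] W) δ₂ ∈ Δ := hΔ.stable g hg δ₂ hδ₂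
    have hδy : B δ (((g : (W →ₗ[ℚ] W)ˣ) : W →ₗ[ℚ] W) δ₂) = 1 := by
      rw [← hgδ, transvectionGroup_isometry B hB Δ hg, h12]
    have ht : ∃ z ∈ Submodule.span ℤ Δ, x = δ + (2 : ℚ) • z :=
      ⟨z, hz, by rw [two_smul, ← two_nsmul, ← hxδ, add_sub_cancel]⟩
    obtain ⟨g', hg', hg'δ⟩ := unimodularTransitivity_skewVanishingLattice B hB Δ hΔ hδ
      hyΔ hδy ht ⟨y', hy', hxy'⟩
    rw [← hg'δ]
    exact hΔ.stable g' hg' δ hδ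

end Part4

end Literature.AlgebraicGeometry.HodgeTheory.VanishingLattice

end
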